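import Summits.ResolutionOfSingularities.ResolutionOfSingularities.Theorems.FrobeniusLadderFInjectiveMacaulayficationFedderEtaleAscent
import Summits.ResolutionOfSingularities.ResolutionOfSingularities.Theorems.FrobeniusLadderFInjectiveMacaulayficationSeparableBaseChangeAscent
import Literature.AlgebraicGeometry.Resolution.LogRegularEtaleLocal
import Mathlib.RingTheory.Regular.Flat
import Mathlib.RingTheory.Flat.FaithfullyFlat.Basic
import Literature.AlgebraicGeometry.Resolution.CohenMacaulaySystemsOfParameters
import Mathlib.RingTheory.Flat.FaithfullyFlat.Algebra
import HarnessLib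

/-!
# The étale transport layer for FULL / CM / regular stalk clauses (BED Ω global patch, F4(c)/F6)

[OURS · L1 W4.5a] Support file (`--supports stmt-ResolutionOfSingularities-15315 --as helper`); theorems only; pure commutative algebra;
unconditional. Nothing of the crux is proved; no census.

The consumer (stub-3's global patch of the Ω₁ cure) compares the stalk `A` of the ACTUAL cured space with the stalk `B` of a MODEL chart
through a common étale neighbourhood `A → C ← B`. One LEG is `[Algebra A C] [Module.Flat A C]` of Noetherian local rings with
`𝔪_A·C = 𝔪_C` (`hunr`); `IsLocalHom` and faithful flatness are DERIVED (§0). §1 one leg: `dim C = dim A`, `IsRegularLocalRing C ↔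
IsRegularLocalRing A` (Literature, Matsumura 15.1/23.7, re-exported in leg form), ★ `CMCl C ↔ CMCl A` (descent: parameter systems extend
and weakly regular sequences descend, §00; ASCENT via `cmClause_iff_exists_isRegular` and flat ascent), ★ `FCl p C → FCl p A`,
★★ `FullCl p C → FullCl p A`. FCl/FullCl do NOT ascend generically along a leg («one parameter ideal Frobenius closed ⇒ all» is
local-cohomology-sized); ascent is supplied in the hypersurface frame. §2 two legs: `dim`, regularity, `CMCl` transport; FULL at the
apex gives FULL at both feet. §3 hypersurface frame (FULL BOTH WAYS): `R₁ → R₃ ← R₂`, `R₁, R₂` regular local of char `p`, `R₃` local,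
`fᵢ ∈ 𝔪ᵢ ∖ 0`, `(φ₁ f₁) = (φ₂ f₂)` in `R₃` ⇒ Fedder test, order condition, `CMCl ∧ FCl p` and (given domains) `FullCl p` of `Rᵢ/(fᵢ)`
transport; §3b the one-leg version up to a unit (chart 5/23 shape).
[cite: Matsumura1987, Thm. 7.5, Thm. 15.1, Thm. 17.4, Thm. 23.3, Thm. 23.7; Fedder1983, Thm. 1.12]
-/

-- single-problem summit: the doubled namespace component is forced
set_option linter.dupNamespace false

noncomputable section

namespace Summit.ResolutionOfSingularities.ResolutionOfSingularities.Theorems.FInjectiveMacaulayfication.EtaleModelTransport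

open IsLocalRing Literature.RingTheory.TightClosure Literature.AlgebraicGeometry.Resolution RingTheory.Sequence
open scoped TensorProduct
open Summit.ResolutionOfSingularities.ResolutionOfSingularities.Theorems.FInjectiveMacaulayfication SliceableCentre

/-! ## §00 Weakly regular sequences descend along faithfully flat base change
(adapted verbatim from `Literature/AlgebraicGeometry/Resolution/CohenMacaulayFlatDescent.lean`, whose module is not yet built on the
farm; private here, cite that file) -/

section Descent

variable {R S M N : Type*} [CommRing R] [CommRing S] [Algebra R S]
  [AddCommGroup M] [Module R M] [AddCommGroup N] [Module R N] [Module S N] [IsScalarTower R S N]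
  [Module.FaithfullyFlat R S]

/-- Regular elements descend along faithfully flat base change. [cite: Matsumura1987, Thm. 23.3 (proof)] -/
private theorem isSMulRegular_of_faithfullyFlat_of_isBaseChange {f : M →ₗ[R] N} (hf : IsBaseChange S f)
    {x : R} (reg : IsSMulRegular N (algebraMap R S x)) : IsSMulRegular M x := by
  have h1 : ∀ z : S ⊗[R] M,
      hf.equiv ((LinearMap.lsmul R M x).lTensor S z) = algebraMap R S x • hf.equiv z := by
    intro z
    induction z using TensorProduct.induction_on with
    | zero => simp
    | tmul s m =>
      simp only [LinearMap.lTensor_tmul, LinearMap.lsmul_apply, IsBaseChange.equiv_tmul,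
        map_smul, algebraMap_smul]
      exact smul_comm s x (f m)
    | add z₁ z₂ h₁ h₂ => simp only [map_add, h₁, h₂, smul_add]
  have key : Function.Injective ((LinearMap.lsmul R M x).lTensor S) := by
    intro z₁ z₂ h
    apply hf.equiv.injective
    apply reg
    change algebraMap R S x • hf.equiv z₁ = algebraMap R S x • hf.equiv z₂
    rw [← h1, ← h1, h]
  exact (Module.FaithfullyFlat.lTensor_injective_iff_injective R S _).mp key

/-- Weakly regular sequences descend along faithfully flat base change. [cite: Matsumura1987, Thm. 23.3 (proof)] -/
private theorem isWeaklyRegular_of_faithfullyFlat_of_isBaseChange {f : M →ₗ[R] N}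
    (hf : IsBaseChange S f) {rs : List R}
    (reg : IsWeaklyRegular N (rs.map (algebraMap R S))) : IsWeaklyRegular M rs := by
  induction rs generalizing M N with
  | nil => exact IsWeaklyRegular.nil R M
  | cons x _ ih =>
    simp only [List.map_cons, isWeaklyRegular_cons_iff] at reg ⊢
    have e := (QuotSMulTop.algebraMapTensorEquivTensorQuotSMulTop x M S).symm ≪≫ₗ
      QuotSMulTop.congr ((algebraMap R S) x) hf.equiv
    have hg : IsBaseChange S <|
        e.toLinearMap.restrictScalars R ∘ₗ TensorProduct.mk R S (QuotSMulTop x M) 1 :=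
      IsBaseChange.of_equiv e (fun _ ↦ by simp)
    exact ⟨isSMulRegular_of_faithfullyFlat_of_isBaseChange hf reg.1, ih hg reg.2⟩

/-- Weakly regular sequences of ring elements DESCEND along faithfully flat algebras. [cite: Matsumura1987, Thm. 23.3 (proof)] -/
private theorem isWeaklyRegular_of_faithfullyFlat {rs : List R}
    (reg : IsWeaklyRegular S (rs.map (algebraMap R S))) : IsWeaklyRegular R rs :=
  isWeaklyRegular_of_faithfullyFlat_of_isBaseChange (IsBaseChange.linearMap R S) reg

end Descent

/-! ## §0 A leg: local and faithfully flat from `𝔪_A·C = 𝔪_C` -/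

section OneLeg

variable {A C : Type} [CommRing A] [CommRing C] [IsLocalRing A] [IsLocalRing C] [Algebra A C]

/-- `𝔪_A·C = 𝔪_C` ⇒ the structure map is a local homomorphism. [plumbing; Mathlib `local_hom_TFAE`] -/
theorem isLocalHom_of_map_maximalIdeal_eq (hunr : (maximalIdeal A).map (algebraMap A C) = maximalIdeal C) :
    IsLocalHom (algebraMap A C) :=
  ((local_hom_TFAE (algebraMap A C)).out 2 0).mp hunr.le

/-- `𝔪_A·C = 𝔪_C` and flat ⇒ faithfully flat. [cite: Matsumura1987, Thm. 7.5] -/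
theorem faithfullyFlat_of_map_maximalIdeal_eq [Module.Flat A C] (hunr : (maximalIdeal A).map (algebraMap A C) = maximalIdeal C) :
    Module.FaithfullyFlat A C := by
  haveI := isLocalHom_of_map_maximalIdeal_eq hunr
  exact Module.FaithfullyFlat.of_flat_of_isLocalHom

omit [IsLocalRing A] [IsLocalRing C] in
/-- The domain clause DESCENDS along a faithfully flat algebra (injective structure map). [folklore] -/
theorem isDomain_of_faithfullyFlat [Module.FaithfullyFlat A C] [IsDomain C] : IsDomain A :=
  Function.Injective.isDomain (algebraMap A C) (FaithfulSMul.algebraMap_injective A C)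

/-! ## §1 What moves along one leg -/

/-- **`dim C = dim A`** along a leg. [cite: Matsumura1987, Thm. 15.1; Literature `ringKrullDim_eq_of_flat_of_map_maximalIdeal_eq`] -/
theorem ringKrullDim_eq [IsNoetherianRing A] [IsNoetherianRing C] [Module.Flat A C]
    (hunr : (maximalIdeal A).map (algebraMap A C) = maximalIdeal C) : ringKrullDim C = ringKrullDim A := by
  haveI := isLocalHom_of_map_maximalIdeal_eq hunr
  exact ringKrullDim_eq_of_flat_of_map_maximalIdeal_eq A C hunr

/-- **REGULARITY IS INVARIANT along a leg** (both ways). [cite: Matsumura1987, Thm. 23.7; Literature `isRegularLocalRing_iff_of_flat_of_map_maximalIdeal_eq`] -/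
theorem isRegularLocalRing_iff [IsNoetherianRing A] [IsNoetherianRing C] [Module.Flat A C]
    (hunr : (maximalIdeal A).map (algebraMap A C) = maximalIdeal C) : IsRegularLocalRing C ↔ IsRegularLocalRing A := by
  haveI := isLocalHom_of_map_maximalIdeal_eq hunr
  exact isRegularLocalRing_iff_of_flat_of_map_maximalIdeal_eq A C hunr

omit [IsLocalRing A] [IsLocalRing C] in
/-- `span (φ ∘ s) = (span s)·C`. [folklore] -/
theorem span_range_comp {ι : Type*} (s : ι → A) :
    Ideal.span (Set.range (algebraMap A C ∘ s)) = (Ideal.span (Set.range s)).map (algebraMap A C) := by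
  rw [Ideal.map_span, Set.range_comp]

/-- **A system of parameters of `A` maps to one of `C`** (radical part): `rad (s) = 𝔪_A` ⇒ `rad ((φ ∘ s)) = 𝔪_C`. [cite: Matsumura1987, Thm. 15.1 (proof)] -/
theorem radical_span_comp_isMaximal [IsNoetherianRing A] (hunr : (maximalIdeal A).map (algebraMap A C) = maximalIdeal C)
    {d : ℕ} (s : Fin d → A) (hs : (Ideal.span (Set.range s)).radical.IsMaximal) :
    (Ideal.span (Set.range (algebraMap A C ∘ s))).radical.IsMaximal := by
  have hradA : (Ideal.span (Set.range s)).radical = maximalIdeal A := IsLocalRing.eq_maximalIdeal hs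
  rw [span_range_comp]
  suffices h : ((Ideal.span (Set.range s)).map (algebraMap A C)).radical = maximalIdeal C by
    rw [h]; exact IsLocalRing.maximalIdeal.isMaximal C
  apply le_antisymm
  · rw [← (IsLocalRing.maximalIdeal.isMaximal C).isPrime.radical, ← hunr]
    exact Ideal.radical_mono (Ideal.map_mono (hradA ▸ Ideal.le_radical))
  · obtain ⟨N, hN⟩ := Ideal.exists_pow_le_of_le_radical_of_fg hradA.ge (IsNoetherian.noetherian (maximalIdeal A))
    have hle : maximalIdeal C ^ N ≤ (Ideal.span (Set.range s)).map (algebraMap A C) := by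
      rw [← hunr, ← Ideal.map_pow]; exact Ideal.map_mono hN
    intro x hx
    exact ⟨N, hle (Ideal.pow_mem_pow hx N)⟩

/-- **THE CM CLAUSE DESCENDS along a leg** (a parameter system of `A` extends to one of `C`; weakly regular sequences descend, §00). [cite: Matsumura1987, Thm. 23.3 Cor.] -/
theorem cmCl_of_leg [IsNoetherianRing A] [IsNoetherianRing C] [Module.Flat A C]
    (hunr : (maximalIdeal A).map (algebraMap A C) = maximalIdeal C) (hC : CMCl C) : CMCl A := by
  haveI := faithfullyFlat_of_map_maximalIdeal_eq hunr
  intro d hd s hs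
  have hreg := hC d ((ringKrullDim_eq hunr).trans hd) (algebraMap A C ∘ s) (radical_span_comp_isMaximal hunr s hs)
  rw [← List.map_ofFn] at hreg
  exact isWeaklyRegular_of_faithfullyFlat hreg

/-- ★ **THE CM CLAUSE ASCENDS along a leg**: a maximal regular sequence of `A` stays regular in `C` (flatness), lies in `𝔪_C`, and has
length `dim A = dim C`; CM is independent of the system of parameters. [cite: Matsumura1987, Thm. 17.4 (iii), Thm. 23.3] -/
theorem cmCl_leg_of [IsNoetherianRing A] [IsNoetherianRing C] [Module.Flat A C]
    (hunr : (maximalIdeal A).map (algebraMap A C) = maximalIdeal C) (hA : CMCl A) : CMCl C := by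
  obtain ⟨rs, hreg, hmem, hlen⟩ := exists_isRegular_of_cmClause hA
  have hmem' : ∀ r ∈ rs.map (algebraMap A C), r ∈ maximalIdeal C := by
    intro r hr
    obtain ⟨a, ha, rfl⟩ := List.mem_map.1 hr
    rw [← hunr]; exact Ideal.mem_map_of_mem _ (hmem a ha)
  refine cmClause_of_exists_isRegular ⟨rs.map (algebraMap A C), ?_, hmem', ?_⟩
  · exact IsRegular.of_isWeaklyRegular_of_mem_maximalIdeal (L := C) hmem' hreg.1.of_flat
  · rw [List.length_map, ringKrullDim_eq hunr]; exact hlen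

/-- ★ **THE CM CLAUSE IS INVARIANT along a leg.** [cite: Matsumura1987, Thm. 23.3] -/
theorem cmCl_iff [IsNoetherianRing A] [IsNoetherianRing C] [Module.Flat A C]
    (hunr : (maximalIdeal A).map (algebraMap A C) = maximalIdeal C) : CMCl C ↔ CMCl A :=
  ⟨cmCl_of_leg hunr, cmCl_leg_of hunr⟩

omit [IsLocalRing A] [IsLocalRing C] in
/-- The Frobenius-type span `⟨z^q : z ∈ I⟩` maps into the one of `I·C`. [plumbing] -/
theorem map_span_pow_image_le (I : Ideal A) (q : ℕ) :
    (Ideal.span ((fun z : A => z ^ q) '' (I : Set A))).map (algebraMap A C) ≤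
      Ideal.span ((fun z : C => z ^ q) '' (I.map (algebraMap A C) : Set C)) := by
  rw [Ideal.map_span]
  refine Ideal.span_mono ?_
  rintro _ ⟨_, ⟨z, hz, rfl⟩, rfl⟩
  exact ⟨algebraMap A C z, Ideal.mem_map_of_mem _ hz, by simp only [map_pow]⟩

/-- ★ **THE F-CLAUSE DESCENDS along a leg**: a parameter ideal `(s)` of `A` extends to the parameter ideal `(φ∘s)` of `C`; if
`y^q ∈ (s)^{[q]}` then `φ(y)^q ∈ (φ∘s)^{[q]}`, so `φ y ∈ (s)·C` and `y ∈ (s)·C ∩ A = (s)` by faithful flatness. [folklore; cite: Matsumura1987, Thm. 7.5] -/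
theorem fCl_of_leg (p : ℕ) [IsNoetherianRing A] [IsNoetherianRing C] [Module.Flat A C]
    (hunr : (maximalIdeal A).map (algebraMap A C) = maximalIdeal C) (hC : FCl p C) : FCl p A := by
  haveI := faithfullyFlat_of_map_maximalIdeal_eq hunr
  intro d hd s hs y hy
  obtain ⟨e, he⟩ := hy
  have hdC : ringKrullDim C = d := (ringKrullDim_eq hunr).trans hd
  have h1 : algebraMap A C y ∈ Ideal.span (Set.range (algebraMap A C ∘ s)) := by
    refine hC d hdC (algebraMap A C ∘ s) (radical_span_comp_isMaximal hunr s hs) _ ⟨e, ?_⟩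
    rw [← map_pow, span_range_comp]
    exact map_span_pow_image_le _ _ (Ideal.mem_map_of_mem _ he)
  rwa [span_range_comp, ← Ideal.mem_comap, Ideal.comap_map_eq_self_of_faithfullyFlat] at h1

/-- ★★ **FULL DESCENDS along a leg**: `FullCl p C → FullCl p A` (domain clause by injectivity, CM and F clauses by the two
descents above, parameter system by parameter system). [OURS · BED Ω global patch F4(c)/F6; cite: Matsumura1987, Thm. 7.5, 15.1, 23.3] -/
theorem fullCl_of_leg (p : ℕ) [IsNoetherianRing A] [IsNoetherianRing C] [Module.Flat A C]
    (hunr : (maximalIdeal A).map (algebraMap A C) = maximalIdeal C) (hC : FullCl p C) : FullCl p A := by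
  haveI := faithfullyFlat_of_map_maximalIdeal_eq hunr
  haveI : IsDomain C := hC.1
  have h2 := (SeparableBaseChangeAscent.cmCl_and_fCl_iff p C).2 hC.2
  exact ⟨isDomain_of_faithfullyFlat (C := C), (SeparableBaseChangeAscent.cmCl_and_fCl_iff p A).1
    ⟨cmCl_of_leg hunr h2.1, fCl_of_leg p hunr h2.2⟩⟩

/-- **`f ∈ 𝔪_Aⁿ ↔ φ f ∈ 𝔪_Cⁿ`** along a leg (orders of functions are étale-local). [folklore; cite: Matsumura1987, Thm. 7.5] -/
theorem mem_pow_iff [Module.Flat A C] (hunr : (maximalIdeal A).map (algebraMap A C) = maximalIdeal C) (n : ℕ) (f : A) :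
    f ∈ maximalIdeal A ^ n ↔ algebraMap A C f ∈ maximalIdeal C ^ n := by
  haveI := faithfullyFlat_of_map_maximalIdeal_eq hunr
  rw [← hunr, ← Ideal.map_pow]
  refine ⟨fun h => Ideal.mem_map_of_mem _ h, fun h => ?_⟩
  rwa [← Ideal.mem_comap, Ideal.comap_map_eq_self_of_faithfullyFlat] at h

/-- **The Fedder test `f^{p−1} ∉ 𝔪^{[p]}` is invariant along a leg.** [✓ `FedderEtaleAscent`; cite: Fedder1983, Thm. 1.12] -/
theorem fedderTest_iff (p : ℕ) [Fact p.Prime] [CharP A p] [CharP C p] [Module.Flat A C]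
    (hunr : (maximalIdeal A).map (algebraMap A C) = maximalIdeal C) (f : A) :
    f ^ (p - 1) ∉ frobeniusPower p (maximalIdeal A) ↔ (algebraMap A C f) ^ (p - 1) ∉ frobeniusPower p (maximalIdeal C) := by
  haveI := faithfullyFlat_of_map_maximalIdeal_eq hunr
  rw [← map_pow]
  exact ⟨FedderEtaleAscent.not_mem_frobeniusPower_of_faithfullyFlat p hunr, FedderEtaleAscent.not_mem_frobeniusPower_of_map p hunr⟩

end OneLeg

/-! ## §2 Two legs: `A → C ← B` -/

section TwoLegs

variable {A B C : Type} [CommRing A] [CommRing B] [CommRing C] [IsLocalRing A] [IsLocalRing B] [IsLocalRing C]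
  [IsNoetherianRing A] [IsNoetherianRing B] [IsNoetherianRing C] [Algebra A C] [Algebra B C] [Module.Flat A C] [Module.Flat B C]

/-- **`dim A = dim B`** across a common étale neighbourhood. [cite: Matsumura1987, Thm. 15.1] -/
theorem ringKrullDim_transport (hA : (maximalIdeal A).map (algebraMap A C) = maximalIdeal C)
    (hB : (maximalIdeal B).map (algebraMap B C) = maximalIdeal C) : ringKrullDim A = ringKrullDim B :=
  (ringKrullDim_eq hA).symm.trans (ringKrullDim_eq hB)

/-- ★ **REGULARITY TRANSPORTS** across a common étale neighbourhood (the regular-off-the-fibre clause of F4(c)). [cite: Matsumura1987, Thm. 23.7] -/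
theorem isRegularLocalRing_transport (hA : (maximalIdeal A).map (algebraMap A C) = maximalIdeal C)
    (hB : (maximalIdeal B).map (algebraMap B C) = maximalIdeal C) : IsRegularLocalRing A ↔ IsRegularLocalRing B :=
  (isRegularLocalRing_iff hA).symm.trans (isRegularLocalRing_iff hB)

/-- ★ **THE CM CLAUSE TRANSPORTS** across a common étale neighbourhood. [cite: Matsumura1987, Thm. 23.3] -/
theorem cmCl_transport (hA : (maximalIdeal A).map (algebraMap A C) = maximalIdeal C)
    (hB : (maximalIdeal B).map (algebraMap B C) = maximalIdeal C) : CMCl A ↔ CMCl B :=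
  (cmCl_iff hA).symm.trans (cmCl_iff hB)

/-- ★ **FULL AT THE APEX GIVES FULL AT BOTH FEET.** [OURS] -/
theorem fullCl_pair_of_apex (p : ℕ) (hA : (maximalIdeal A).map (algebraMap A C) = maximalIdeal C)
    (hB : (maximalIdeal B).map (algebraMap B C) = maximalIdeal C) (hC : FullCl p C) : FullCl p A ∧ FullCl p B :=
  ⟨fullCl_of_leg p hA hC, fullCl_of_leg p hB hC⟩

end TwoLegs

/-! ## §3 The hypersurface frame: FULL both ways through Fedder's test -/

section Hypersurface

variable {R₁ R₂ R₃ : Type} [CommRing R₁] [CommRing R₂] [CommRing R₃] [IsLocalRing R₃] [Algebra R₁ R₃] [Algebra R₂ R₃]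

omit [IsLocalRing R₃] [Algebra R₁ R₃] [Algebra R₂ R₃] in
/-- Generators of the same principal ideal pass the same power-membership tests. [plumbing] -/
theorem pow_mem_of_span_eq {g₁ g₂ : R₃} (h : Ideal.span ({g₁} : Set R₃) = Ideal.span {g₂}) (J : Ideal R₃) (n : ℕ)
    (h₁ : g₁ ^ n ∈ J) : g₂ ^ n ∈ J := by
  have hg : g₂ ∈ Ideal.span ({g₁} : Set R₃) := h ▸ Ideal.mem_span_singleton_self g₂
  obtain ⟨a, ha⟩ := Ideal.mem_span_singleton'.1 hg
  rw [← ha, mul_pow]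
  exact J.mul_mem_left _ h₁

omit [IsLocalRing R₃] [Algebra R₁ R₃] [Algebra R₂ R₃] in
/-- … hence the same NON-membership tests. [plumbing] -/
theorem pow_not_mem_iff_of_span_eq {g₁ g₂ : R₃} (h : Ideal.span ({g₁} : Set R₃) = Ideal.span {g₂}) (J : Ideal R₃) (n : ℕ) :
    g₁ ^ n ∉ J ↔ g₂ ^ n ∉ J :=
  not_congr ⟨pow_mem_of_span_eq h J n, pow_mem_of_span_eq h.symm J n⟩

/-- ★ **THE FEDDER TEST TRANSPORTS** across `R₁ → R₃ ← R₂` when `(φ₁ f₁) = (φ₂ f₂)` in `R₃`. [cite: Fedder1983, Thm. 1.12; Matsumura1987, Thm. 7.5] -/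
theorem fedderTest_transport (p : ℕ) [Fact p.Prime] [IsLocalRing R₁] [IsLocalRing R₂] [CharP R₁ p] [CharP R₂ p] [CharP R₃ p]
    [Module.Flat R₁ R₃] [Module.Flat R₂ R₃]
    (h₁ : (maximalIdeal R₁).map (algebraMap R₁ R₃) = maximalIdeal R₃) (h₂ : (maximalIdeal R₂).map (algebraMap R₂ R₃) = maximalIdeal R₃)
    (f₁ : R₁) (f₂ : R₂) (hspan : Ideal.span ({algebraMap R₁ R₃ f₁} : Set R₃) = Ideal.span {algebraMap R₂ R₃ f₂}) :
    f₁ ^ (p - 1) ∉ frobeniusPower p (maximalIdeal R₁) ↔ f₂ ^ (p - 1) ∉ frobeniusPower p (maximalIdeal R₂) := by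
  rw [fedderTest_iff p h₁, fedderTest_iff p h₂]
  exact pow_not_mem_iff_of_span_eq hspan _ _

/-- ★ **THE ORDER CONDITION TRANSPORTS**: `f₁ ∈ 𝔪₁ⁿ ↔ f₂ ∈ 𝔪₂ⁿ` (e.g. `n = 2`: `Rᵢ/(fᵢ)` singular). [folklore; cite: Matsumura1987, Thm. 7.5] -/
theorem mem_pow_transport [IsLocalRing R₁] [IsLocalRing R₂] [Module.Flat R₁ R₃] [Module.Flat R₂ R₃]
    (h₁ : (maximalIdeal R₁).map (algebraMap R₁ R₃) = maximalIdeal R₃) (h₂ : (maximalIdeal R₂).map (algebraMap R₂ R₃) = maximalIdeal R₃)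
    (f₁ : R₁) (f₂ : R₂) (hspan : Ideal.span ({algebraMap R₁ R₃ f₁} : Set R₃) = Ideal.span {algebraMap R₂ R₃ f₂}) (n : ℕ) :
    f₁ ∈ maximalIdeal R₁ ^ n ↔ f₂ ∈ maximalIdeal R₂ ^ n := by
  rw [mem_pow_iff h₁, mem_pow_iff h₂, ← pow_one (algebraMap R₁ R₃ f₁), ← pow_one (algebraMap R₂ R₃ f₂)]
  exact ⟨pow_mem_of_span_eq hspan _ 1, pow_mem_of_span_eq hspan.symm _ 1⟩

/-- ★★ **THE STALK CLAUSE OF A HYPERSURFACE TRANSPORTS** across `R₁ → R₃ ← R₂` (`R₁, R₂` regular local of char `p`, `R₃` local, both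
legs flat with `𝔪ᵢ·R₃ = 𝔪₃`, `fᵢ ∈ 𝔪ᵢ ∖ 0`, `(φ₁ f₁) = (φ₂ f₂)`): `CMCl ∧ FCl p` holds for `R₁/(f₁)` iff for `R₂/(f₂)` — BOTH WAYS
(Fedder's criterion on both feet, the test transported through the apex). [OURS · BED Ω global patch F4(c)/F6; cite: Fedder1983, Thm. 1.12] -/
theorem clause_hypersurface_transport (p : ℕ) [Fact p.Prime] [IsRegularLocalRing R₁] [IsRegularLocalRing R₂] [CharP R₁ p] [CharP R₂ p]
    [CharP R₃ p] [Module.Flat R₁ R₃] [Module.Flat R₂ R₃]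
    (h₁ : (maximalIdeal R₁).map (algebraMap R₁ R₃) = maximalIdeal R₃) (h₂ : (maximalIdeal R₂).map (algebraMap R₂ R₃) = maximalIdeal R₃)
    (f₁ : R₁) (f₂ : R₂) (hf₁ : f₁ ∈ maximalIdeal R₁) (hf₁0 : f₁ ≠ 0) (hf₂ : f₂ ∈ maximalIdeal R₂) (hf₂0 : f₂ ≠ 0)
    (hspan : Ideal.span ({algebraMap R₁ R₃ f₁} : Set R₃) = Ideal.span {algebraMap R₂ R₃ f₂}) :
    (CMCl (R₁ ⧸ Ideal.span ({f₁} : Set R₁)) ∧ FCl p (R₁ ⧸ Ideal.span ({f₁} : Set R₁))) ↔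
      (CMCl (R₂ ⧸ Ideal.span ({f₂} : Set R₂)) ∧ FCl p (R₂ ⧸ Ideal.span ({f₂} : Set R₂))) := by
  rw [SeparableBaseChangeAscent.cmCl_and_fCl_iff, SeparableBaseChangeAscent.cmCl_and_fCl_iff,
    Fedder.fedder_criterion p R₁ f₁ hf₁ hf₁0, Fedder.fedder_criterion p R₂ f₂ hf₂ hf₂0]
  exact fedderTest_transport p h₁ h₂ f₁ f₂ hspan

/-- ★★ **FULL TRANSPORTS FROM THE MODEL TO THE ACTUAL STALK** in the hypersurface frame: `FullCl p (R₂/(f₂))` and the domain clause of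
`R₁/(f₁)` (global: blow-ups of integral schemes are integral) ⇒ `FullCl p (R₁/(f₁))`. [OURS · BED Ω global patch F4(c)/F6] -/
theorem fullCl_hypersurface_transport (p : ℕ) [Fact p.Prime] [IsRegularLocalRing R₁] [IsRegularLocalRing R₂] [CharP R₁ p] [CharP R₂ p]
    [CharP R₃ p] [Module.Flat R₁ R₃] [Module.Flat R₂ R₃]
    (h₁ : (maximalIdeal R₁).map (algebraMap R₁ R₃) = maximalIdeal R₃) (h₂ : (maximalIdeal R₂).map (algebraMap R₂ R₃) = maximalIdeal R₃)
    (f₁ : R₁) (f₂ : R₂) (hf₁ : f₁ ∈ maximalIdeal R₁) (hf₁0 : f₁ ≠ 0) (hf₂ : f₂ ∈ maximalIdeal R₂) (hf₂0 : f₂ ≠ 0)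
    (hspan : Ideal.span ({algebraMap R₁ R₃ f₁} : Set R₃) = Ideal.span {algebraMap R₂ R₃ f₂})
    (hM : FullCl p (R₂ ⧸ Ideal.span ({f₂} : Set R₂))) (hdom : IsDomain (R₁ ⧸ Ideal.span ({f₁} : Set R₁))) :
    FullCl p (R₁ ⧸ Ideal.span ({f₁} : Set R₁)) :=
  ⟨hdom, (SeparableBaseChangeAscent.cmCl_and_fCl_iff p _).1 ((clause_hypersurface_transport p h₁ h₂ f₁ f₂ hf₁ hf₁0 hf₂ hf₂0 hspan).2
    ((SeparableBaseChangeAscent.cmCl_and_fCl_iff p _).2 hM.2))⟩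

/-- ★★ **FULL IS INVARIANT** in the hypersurface frame when both feet are domains. [OURS] -/
theorem fullCl_hypersurface_iff (p : ℕ) [Fact p.Prime] [IsRegularLocalRing R₁] [IsRegularLocalRing R₂] [CharP R₁ p] [CharP R₂ p]
    [CharP R₃ p] [Module.Flat R₁ R₃] [Module.Flat R₂ R₃]
    (h₁ : (maximalIdeal R₁).map (algebraMap R₁ R₃) = maximalIdeal R₃) (h₂ : (maximalIdeal R₂).map (algebraMap R₂ R₃) = maximalIdeal R₃)
    (f₁ : R₁) (f₂ : R₂) (hf₁ : f₁ ∈ maximalIdeal R₁) (hf₁0 : f₁ ≠ 0) (hf₂ : f₂ ∈ maximalIdeal R₂) (hf₂0 : f₂ ≠ 0)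
    (hspan : Ideal.span ({algebraMap R₁ R₃ f₁} : Set R₃) = Ideal.span {algebraMap R₂ R₃ f₂})
    (hd₁ : IsDomain (R₁ ⧸ Ideal.span ({f₁} : Set R₁))) (hd₂ : IsDomain (R₂ ⧸ Ideal.span ({f₂} : Set R₂))) :
    FullCl p (R₁ ⧸ Ideal.span ({f₁} : Set R₁)) ↔ FullCl p (R₂ ⧸ Ideal.span ({f₂} : Set R₂)) :=
  ⟨fun h => fullCl_hypersurface_transport p h₂ h₁ f₂ f₁ hf₂ hf₂0 hf₁ hf₁0 hspan.symm h hd₂,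
    fun h => fullCl_hypersurface_transport p h₁ h₂ f₁ f₂ hf₁ hf₁0 hf₂ hf₂0 hspan h hd₁⟩

end Hypersurface

/-! ## §3b One hypersurface leg (chart 5/23 shape: the ACTUAL ambient stalk is standard-étale OVER the MODEL one) -/

section HypersurfaceLeg

variable {R R' : Type} [CommRing R] [CommRing R'] [Algebra R R']

/-- A generator of the extended principal ideal is again in `𝔪′ ∖ 0`. [plumbing] -/
theorem mem_and_ne_zero_of_span_eq [IsLocalRing R] [IsLocalRing R'] [Module.Flat R R']
    (hunr : (maximalIdeal R).map (algebraMap R R') = maximalIdeal R') (f : R) (hfm : f ∈ maximalIdeal R) (hf0 : f ≠ 0) (f' : R')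
    (hspan : Ideal.span ({algebraMap R R' f} : Set R') = Ideal.span {f'}) : f' ∈ maximalIdeal R' ∧ f' ≠ 0 := by
  haveI := faithfullyFlat_of_map_maximalIdeal_eq hunr
  have hf'mem : f' ∈ Ideal.span ({algebraMap R R' f} : Set R') := hspan ▸ Ideal.mem_span_singleton_self f'
  obtain ⟨a, ha⟩ := Ideal.mem_span_singleton'.1 hf'mem
  refine ⟨?_, fun h0 => ?_⟩
  · rw [← ha, ← hunr]; exact Ideal.mul_mem_left _ _ (Ideal.mem_map_of_mem _ hfm)
  · have hmem : algebraMap R R' f ∈ Ideal.span ({f'} : Set R') := hspan.symm ▸ Ideal.mem_span_singleton_self _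
    rw [h0, Ideal.span_singleton_zero, Ideal.mem_bot] at hmem
    exact hf0 (FaithfulSMul.algebraMap_injective R R' (by rw [hmem, map_zero]))

/-- ★★ **THE STALK CLAUSE ALONG ONE HYPERSURFACE LEG, UP TO A UNIT**: `R → R′` a leg of regular local rings of char `p`, `f ∈ 𝔪_R ∖ 0`,
`f′ ∈ R′` with `(φ f) = (f′)` ⇒ (`CMCl ∧ FCl p` for `R/(f)`) ↔ (the same for `R′/(f′)`) — ✓ `FedderEtaleAscent.clause_hypersurface_iff_of_faithfullyFlat`
freed from the literal equality `f′ = φ f` (the letters give `φ(Φ_W) = unit · f_actual`). [OURS · chart 5/23 leg; cite: Fedder1983, Thm. 1.12] -/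
theorem clause_hypersurface_leg_iff (p : ℕ) [Fact p.Prime] [IsRegularLocalRing R] [IsRegularLocalRing R'] [CharP R p] [CharP R' p] [Module.Flat R R']
    (hunr : (maximalIdeal R).map (algebraMap R R') = maximalIdeal R') (f : R) (hfm : f ∈ maximalIdeal R) (hf0 : f ≠ 0) (f' : R')
    (hspan : Ideal.span ({algebraMap R R' f} : Set R') = Ideal.span {f'}) :
    (CMCl (R ⧸ Ideal.span ({f} : Set R)) ∧ FCl p (R ⧸ Ideal.span ({f} : Set R))) ↔
      (CMCl (R' ⧸ Ideal.span ({f'} : Set R')) ∧ FCl p (R' ⧸ Ideal.span ({f'} : Set R'))) := by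
  obtain ⟨hf'm, hf'0⟩ := mem_and_ne_zero_of_span_eq hunr f hfm hf0 f' hspan
  rw [SeparableBaseChangeAscent.cmCl_and_fCl_iff, SeparableBaseChangeAscent.cmCl_and_fCl_iff,
    Fedder.fedder_criterion p R f hfm hf0, Fedder.fedder_criterion p R' f' hf'm hf'0, fedderTest_iff p hunr f]
  exact pow_not_mem_iff_of_span_eq hspan _ _

/-- ★★ **FULL ASCENDS FROM THE MODEL TO THE ACTUAL STALK along one hypersurface leg** (chart 5/23: model `R/(f)` FULL, actual
`R′/(f′)` a domain ⇒ actual FULL). [OURS · BED Ω global patch F6] -/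
theorem fullCl_hypersurface_leg_of (p : ℕ) [Fact p.Prime] [IsRegularLocalRing R] [IsRegularLocalRing R'] [CharP R p] [CharP R' p] [Module.Flat R R']
    (hunr : (maximalIdeal R).map (algebraMap R R') = maximalIdeal R') (f : R) (hfm : f ∈ maximalIdeal R) (hf0 : f ≠ 0) (f' : R')
    (hspan : Ideal.span ({algebraMap R R' f} : Set R') = Ideal.span {f'}) (hM : FullCl p (R ⧸ Ideal.span ({f} : Set R)))
    (hdom : IsDomain (R' ⧸ Ideal.span ({f'} : Set R'))) : FullCl p (R' ⧸ Ideal.span ({f'} : Set R')) :=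
  ⟨hdom, (SeparableBaseChangeAscent.cmCl_and_fCl_iff p _).1 ((clause_hypersurface_leg_iff p hunr f hfm hf0 f' hspan).1
    ((SeparableBaseChangeAscent.cmCl_and_fCl_iff p _).2 hM.2))⟩

/-- ★ … and DESCENDS (actual FULL, model a domain ⇒ model FULL) — NOT-FULL of the model is visible on the actual space. [OURS] -/
theorem fullCl_of_hypersurface_leg (p : ℕ) [Fact p.Prime] [IsRegularLocalRing R] [IsRegularLocalRing R'] [CharP R p] [CharP R' p] [Module.Flat R R']
    (hunr : (maximalIdeal R).map (algebraMap R R') = maximalIdeal R') (f : R) (hfm : f ∈ maximalIdeal R) (hf0 : f ≠ 0) (f' : R')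
    (hspan : Ideal.span ({algebraMap R R' f} : Set R') = Ideal.span {f'}) (hA : FullCl p (R' ⧸ Ideal.span ({f'} : Set R')))
    (hdom : IsDomain (R ⧸ Ideal.span ({f} : Set R))) : FullCl p (R ⧸ Ideal.span ({f} : Set R)) :=
  ⟨hdom, (SeparableBaseChangeAscent.cmCl_and_fCl_iff p _).1 ((clause_hypersurface_leg_iff p hunr f hfm hf0 f' hspan).2
    ((SeparableBaseChangeAscent.cmCl_and_fCl_iff p _).2 hA.2))⟩

/-- ★ **REGULARITY OF THE HYPERSURFACE along one leg**: `f ∈ 𝔪_R² ↔ f′ ∈ 𝔪_{R′}²` (the order of the equation is étale-local). [folklore] -/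
theorem mem_sq_leg_iff [IsLocalRing R] [IsLocalRing R'] [Module.Flat R R']
    (hunr : (maximalIdeal R).map (algebraMap R R') = maximalIdeal R') (f : R) (f' : R')
    (hspan : Ideal.span ({algebraMap R R' f} : Set R') = Ideal.span {f'}) (n : ℕ) :
    f ∈ maximalIdeal R ^ n ↔ f' ∈ maximalIdeal R' ^ n := by
  rw [mem_pow_iff hunr, ← pow_one (algebraMap R R' f), ← pow_one f']
  exact ⟨pow_mem_of_span_eq hspan _ 1, pow_mem_of_span_eq hspan.symm _ 1⟩

end HypersurfaceLeg

end Summit.ResolutionOfSingularities.ResolutionOfSingularities.Theorems.FInjectiveMacaulayfication.EtaleModelTransport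

end
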